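import Summits.NavierStokesRegularity.FluidComputer.BlockHandoff

/-!
# Fourier-block design, IV: the statics assembled — `ShadowedCircuit` from its dynamical residue

HONEST FRAMING (cell `pub-fluidc`, verbatim): *low prior, high value-of-information experiment on
Tao's machine paradigm; NOT a claim that NS blows up.*

For the concrete Fourier-block design of `BlockReadout` / `BlockHandoff` (one Tao wavelet per
dyadic block, `λ₀ = 1`, observable space `ℝ × ℝ`, homogeneous junk weight of order `s`), this file

* supplies the SEED (`u₀ = aLo √E₀ ψ₀`: Schwartz, divergence free, `H¹⁰_df`, read in the loaded
  core of generation `0`, junk `0`);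
* records a STANDARD parameter set `Params.std` (`s = 10`, `μ = 1`, `[aLo,aHi] = [3/2,2]`,
  `c0 = σsp = 1/4`, `δ = 1/2`, `jcore = 1/5 < jin = 1/2 < jrun = 1`) valid over EVERY dyadic spec
  sheet with `λ₀ = 1` and `η > 1/4` — so the READOUT / REGIONS / STATICS / SEED groups of
  `ShadowedCircuit S (ℝ × ℝ) 10` are THEOREMS for this design, with no hypothesis;
* isolates what is left as the structure `Dynamics 𝒟 P`: the finite-dimensional CIRCUIT on `ℝ × ℝ`
  with its delayed-abrupt-transition certificate `dat` (design-level, checkable for a given `Φ`),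
  the CLOCK inequality, and the two idea-bound DYNAMICS claims `shadow` / `leak` about every
  `H¹⁰_df`-mild Navier–Stokes trajectory — exactly the fields of `ShadowedCircuit` not discharged;
* builds `Dynamics.toShadowedCircuit : Dynamics 𝒟 P → ShadowedCircuit S (ℝ × ℝ) P.s`.

What this does NOT do: it does not exhibit a `Dynamics` term. For the true equations `shadow ∧ leak`
(a two-mode readout following a planar circuit while the weighted junk stays below `√E_n`) is Tao's
open programme specialised to the crudest conceivable design, and is presumably FALSE for this
particular two-wavelet design (a single pair of wavelet modes does not evolve autonomously under
Navier–Stokes; ASSEMBLY.md §E7 grades it IDEA-BOUND/implausible-as-is). The value is the exact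
residue: every other axiom of the architecture is now a checked computation for a concrete design.
-/

noncomputable section

open MeasureTheory Set Filter Topology Metric
open scoped ENNReal NNReal SchwartzMap

namespace Summit.NavierStokesRegularity.FluidComputer

open Literature.Analysis.FluidPDE Literature.Analysis.FluidPDE.Tao2016
open Literature.Analysis.FluidPDE.FluidComputer

namespace BlockDesign

/-! ### §1. The seed -/

section Seed

variable (𝒟 : CascadeWaveletData 1 1) {S : CascadeSpecs} (P : Params S)

/-- SEED: `u₀ = aLo √E₀ ψ₀`, the bottom-left corner of the generation-`0` core. [folklore] -/
def seed : 𝓢(EuclideanSpace ℝ (Fin 3), EuclideanSpace ℝ (Fin 3)) :=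
  (P.aLo * Real.sqrt (S.Emin 0)) • 𝒟.ψ 0

/-- `ψ₀` is the undilated profile. [folklore] -/
theorem mode_zero : mode 𝒟 0 = schwartzL2 (𝒟.ψ 0) := by
  rw [mode, Nat.cast_zero, cascadeWavelet, zpow_zero, dil_one]

/-- The seed is the design state `recon 0 (aLo, 0)`. [folklore] -/
theorem schwartzL2_seed : schwartzL2 (seed 𝒟 P) = recon 𝒟 S 0 (P.aLo, 0) := by
  rw [seed, schwartzL2_smul, recon, zero_mul, Complex.ofReal_zero, zero_smul, add_zero, mode_zero]

/-- Scalar multiples of divergence-free Schwartz fields are divergence free. [folklore] -/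
theorem isDivFree_smul (c : ℝ) {f : 𝓢(EuclideanSpace ℝ (Fin 3), EuclideanSpace ℝ (Fin 3))}
    (hf : VectorCalculus.IsDivFree ⇑f) : VectorCalculus.IsDivFree ⇑(c • f) := by
  intro x
  have h := hf x
  unfold VectorCalculus.divergence at h ⊢
  have hcoe : (⇑(c • f) : EuclideanSpace ℝ (Fin 3) → EuclideanSpace ℝ (Fin 3)) = c • ⇑f := by
    ext1 y; simp
  rw [hcoe, fderiv_const_smul (f.differentiableAt) c, ContinuousLinearMap.toLinearMap_smul, map_smul, h,
    smul_zero]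

/-- The seed `aLo √E₀ ψ₀` is divergence free. [folklore] -/
theorem seed_divFree : VectorCalculus.IsDivFree ⇑(seed 𝒟 P) := isDivFree_smul _ (𝒟.isDivFree 0)

/-- The seed lies in `H¹⁰_df`. [folklore] -/
theorem seed_memH10df : MemH10df (schwartzL2 (seed 𝒟 P)) := by
  have h : MemH10df (mode 𝒟 0) := 𝒟.memH10df_cascadeWavelet two_pos' 0 _
  rw [seed, schwartzL2_smul, ← mode_zero]
  exact h.smul _

/-- The seed reads `(aLo, 0) ∈ Acore` at block `0`. [folklore] -/
theorem seed_read : read 𝒟 S 0 (schwartzL2 (seed 𝒟 P)) ∈ Acore P := by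
  rw [schwartzL2_seed, read_recon]
  exact ⟨⟨le_rfl, P.aLo_le_aHi⟩, ⟨by simpa using P.c0_nonneg, P.c0_nonneg⟩⟩

/-- The seed carries no junk at block `0` (it is a design state), in particular `≤ jcore √E₀`. [folklore] -/
theorem seed_junk : junk 𝒟 P 0 (schwartzL2 (seed 𝒟 P)) ≤ ENNReal.ofReal (P.jcore * Real.sqrt (S.Emin 0)) := by
  rw [schwartzL2_seed, junk_recon]; exact zero_le

end Seed

/-! ### §2. A standard parameter set, valid over every spec sheet with `λ₀ = 1`, `η > 1/4` -/

section Std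

variable (S : CascadeSpecs)

/-- `(1/2)^10 = 1/1024` as a real power. [folklore] -/
theorem half_rpow_ten : (1 / 2 : ℝ) ^ (10 : ℝ) = 1 / 1024 := by
  rw [show (10 : ℝ) = ((10 : ℕ) : ℝ) by norm_num, Real.rpow_natCast]; norm_num

/-- `(3/4)^10 = 59049/1048576` as a real power. [folklore] -/
theorem threeQuarter_rpow_ten : (3 / 4 : ℝ) ^ (10 : ℝ) = 59049 / 1048576 := by
  rw [show (10 : ℝ) = ((10 : ℕ) : ℝ) by norm_num, Real.rpow_natCast]; norm_num

/-- `4^10 = 1048576` as a real power. [folklore] -/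
theorem four_rpow_ten : (4 : ℝ) ^ (10 : ℝ) = 1048576 := by
  rw [show (10 : ℝ) = ((10 : ℕ) : ℝ) by norm_num, Real.rpow_natCast]; norm_num

/-- **Standard parameters** (`s = 10`, `μ = 1`, `[aLo, aHi] = [3/2, 2]`, `c0 = σsp = 1/4`,
`δ = 1/2`, `jcore = 1/5`, `jin = 1/2`, `jrun = 1`) over any dyadic spec sheet with `λ₀ = 1` and
`η > 1/4`: the erasure budget is `(2^{-10} + (3/4)^{10})·1 + (3/4)^{10}/4 ≈ 0.0714 ≤ 0.1 < √η/5`,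
and `1 ≤ 4^{10} η/4`. [folklore] -/
def Params.std (hS : S.lam0 = 1) (hη : 1 / 4 < S.eta) : Params S where
  s := 10
  μ := 1
  aLo := 3 / 2
  aHi := 2
  c0 := 1 / 4
  δ := 1 / 2
  σsp := 1 / 4
  jcore := 1 / 5
  jin := 1 / 2
  jrun := 1
  lam0_eq := hS
  s_nonneg := by norm_num
  μ_nonneg := by norm_num
  μ_le_one := le_rfl
  δ_pos := by norm_num
  one_le := by norm_num
  aLo_le_aHi := by norm_num
  c0_nonneg := by norm_num
  jcore_nonneg := by norm_num
  jcore_lt_jin := by norm_num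
  jin_le_jrun := by norm_num
  next_output := by rw [four_rpow_ten]; linarith
  erasure := by
    have hη' : (1 / 2 : ℝ) < Real.sqrt S.eta := by
      rw [Real.lt_sqrt (by norm_num)]; linarith
    rw [half_rpow_ten, threeQuarter_rpow_ten]
    linarith

end Std

/-! ### §3. The dynamical residue and the assembled design -/

section Assembly

variable (𝒟 : CascadeWaveletData 1 1) {S : CascadeSpecs} (P : Params S)

/-- **The residue.** Exactly the CIRCUIT / CLOCK / DYNAMICS fields of `ShadowedCircuit` for the
Fourier-block design (READOUT, REGIONS, STATICS and SEED being theorems): a flow-like family `Φ σ` on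
the observable plane with a delayed abrupt transition certificate `dat` from `Ain` into the
interior of `Aout` within rescaled time `τc` (design-level: a finite-dimensional computation once
`Φ` is written down), a clock fitting one cycle into the spec's allowance, and the two IDEA-BOUND
claims about every `H¹⁰_df`-mild Navier–Stokes trajectory (Euler form, `ν = 1`): its two-block
readout shadows `Φ` (`shadow`) while its weighted junk stays below the running threshold (`leak`).
Nothing asserts this structure is inhabited; for THIS two-wavelet design it presumably is not. [folklore] -/
structure Dynamics where
  /-- CIRCUIT: the design dynamics on the observable plane, in rescaled time -/
  Φ : ℝ → ℝ × ℝ → ℝ × ℝ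
  /-- rescaled cycle time -/
  τc : ℝ
  τc_nonneg : 0 ≤ τc
  /-- shadowing tolerance -/
  δsh : ℝ
  δsh_nonneg : 0 ≤ δsh
  /-- delayed abrupt transition with margin -/
  dat : ∀ p ∈ Ain P, ∃ σ : ℝ, 0 ≤ σ ∧ σ ≤ τc ∧ Metric.closedBall (Φ σ p) δsh ⊆ Aout P
  /-- CLOCK: physical time per unit rescaled time at generation `n` -/
  unit : ℕ → ℝ
  unit_pos : ∀ n, 0 < unit n
  clock : ∀ n, unit n * τc ≤ S.Tmax n
  /-- DYNAMICS (idea-bound): shadowing -/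
  shadow : ∀ (n : ℕ) (a : L2C) (S' : ℝ) (u : ℝ → L2C), IsMildSolutionFor eulerForm a (Ico 0 S') u →
    ∀ t : ℝ, 0 ≤ t → read 𝒟 S n (u t) ∈ Ain P →
      junk 𝒟 P n (u t) ≤ ENNReal.ofReal (P.jin * Real.sqrt (S.Emin n)) →
      ∀ σ : ℝ, 0 ≤ σ → σ ≤ τc → t + unit n * σ < S' →
        dist (read 𝒟 S n (u (t + unit n * σ))) (Φ σ (read 𝒟 S n (u t))) ≤ δsh
  /-- DYNAMICS (idea-bound): leakage -/
  leak : ∀ (n : ℕ) (a : L2C) (S' : ℝ) (u : ℝ → L2C), IsMildSolutionFor eulerForm a (Ico 0 S') u →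
    ∀ t : ℝ, 0 ≤ t → read 𝒟 S n (u t) ∈ Ain P →
      junk 𝒟 P n (u t) ≤ ENNReal.ofReal (P.jin * Real.sqrt (S.Emin n)) →
      ∀ σ : ℝ, 0 ≤ σ → σ ≤ τc → t + unit n * σ < S' →
        junk 𝒟 P n (u (t + unit n * σ)) ≤ ENNReal.ofReal (P.jrun * Real.sqrt (S.Emin n))

variable {𝒟 P}

/-- **The assembled design**: a dynamical residue for the Fourier-block design IS a shadowed circuit
design over `S` with observable space `ℝ × ℝ` and junk exponent `s` — every other field is supplied
by the theorems of `BlockReadout` / `BlockHandoff` / §1. [folklore] -/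
def Dynamics.toShadowedCircuit (Dy : Dynamics 𝒟 P) : ShadowedCircuit S (ℝ × ℝ) P.s where
  read := read 𝒟 S
  recon := recon 𝒟 S
  junk := junk 𝒟 P
  Λ := (Real.sqrt S.eta)⁻¹
  Λ_pos := inv_pos.2 (Real.sqrt_pos.2 S.eta_pos)
  read_lip := fun n v w => read_lip n v w
  junk_perturb := fun n v w => junk_perturb n v w
  read_recon := fun n p => read_recon n p
  junk_recon := fun n p => junk_recon n p
  Ain := Ain P
  Acore := Acore P
  Aout := Aout P
  δ := P.δ
  δ_pos := P.δ_pos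
  core_thick := fun p hp => core_thick p hp
  jcore := P.jcore
  jin := P.jin
  jrun := P.jrun
  jcore_nonneg := P.jcore_nonneg
  jcore_lt := P.jcore_lt_jin
  handoff := fun n v hv hj => handoff n v hv hj
  floor_cert := fun n v hv _ => floor_cert n v hv
  Φ := Dy.Φ
  τc := Dy.τc
  τc_nonneg := Dy.τc_nonneg
  δsh := Dy.δsh
  δsh_nonneg := Dy.δsh_nonneg
  dat := Dy.dat
  unit := Dy.unit
  unit_pos := Dy.unit_pos
  clock := Dy.clock
  shadow := Dy.shadow
  leak := Dy.leak
  u₀ := seed 𝒟 P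
  divFree := seed_divFree 𝒟 P
  memH10df := seed_memH10df 𝒟 P
  seed_read := seed_read 𝒟 P
  seed_junk := seed_junk 𝒟 P

/-- The assembled circuit's readout is the design readout. [folklore] -/
@[simp] theorem Dynamics.toShadowedCircuit_read (Dy : Dynamics 𝒟 P) :
    Dy.toShadowedCircuit.read = read 𝒟 S := rfl

/-- The assembled circuit's reconstruction is the design reconstruction. [folklore] -/
@[simp] theorem Dynamics.toShadowedCircuit_recon (Dy : Dynamics 𝒟 P) :
    Dy.toShadowedCircuit.recon = recon 𝒟 S := rfl

/-- The assembled circuit's junk functional is the design junk functional. [folklore] -/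
@[simp] theorem Dynamics.toShadowedCircuit_junk (Dy : Dynamics 𝒟 P) :
    Dy.toShadowedCircuit.junk = junk 𝒟 P := rfl

/-- The assembled circuit's initial datum is the seed. [folklore] -/
@[simp] theorem Dynamics.toShadowedCircuit_u₀ (Dy : Dynamics 𝒟 P) :
    Dy.toShadowedCircuit.u₀ = seed 𝒟 P := rfl

/-- The design data exist: Tao's wavelet data with `ε₀ = 1`, one profile. [cite: Tao2016AveragedNS, §4 p. 21] -/
theorem nonempty_design : Nonempty (CascadeWaveletData 1 1) :=
  nonempty_cascadeWaveletData one_pos 1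

end Assembly

end BlockDesign

end Summit.NavierStokesRegularity.FluidComputer

end
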